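import Summits.AtomisticToContinuum.Crystallization.Theses.PeriodCoherenceLadder

/-!
# Route `PeriodCoherenceLadder`, residual crux `MesoscopicCoarsePeriods`: reduction to CLEAN REGIONS AT EVERY SCALE

`MesoscopicCoarsePeriods` (item r2, the node's declared residual) asks for ONE Delone hull point of the
Lennard-Jones ground states in which EVERY ball of radius `4b` carries a coarse period of its own (orientation
free from ball to ball).  This file proves the compactness half of the line beneath it:

* `mesoscopic_of_cleanRegions` — if, with uniform constants `(δ, r, b)`, for every radius `L` some `δ`-separated
  `r`-dense hull point `X_L` is CLEAN on the window `‖c‖ ≤ L` (every ball `B(c, 4b + 1)` centred in the window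
  has a local coarse period `t_c`, `δ ≤ ‖t_c‖ ≤ b`, precision `δ/4`, two-sided), then some Delone hull point is
  clean EVERYWHERE, i.e. the conclusion of `MesoscopicCoarsePeriods` holds.  Local-matching compactness of the
  `X_L` (block A of `Theorems.PeriodPrecisionLadderExactPeriodFromFine`), then — centre by centre — Bolzano–Weierstrass
  for the local translations, the window radius escaping to infinity, and the ATTAINED infimum `δ/4` (uniform
  discreteness).  The slack `+ 1` in the hypothesis' ball radius absorbs the matching error at the rim of the
  ball; it is free in every intended application (a clean region of size `L` is clean at radius `4b + 1` on the
  window of size `L - 1`).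
* `mesoscopicCoarsePeriods_of_cleanRegions` — the packaged reduction: the crux follows from «LJ ground states have,
  at every scale, a Delone hull point clean near the origin» (the remaining, Lennard-Jones-specific statement of
  the line: energy localisation of frustration + `o(N)` excess energy + counting; see the crux's skeleton).

[BaakeGrimm2013 Remark 5.6, Prop. 5.3; KellendonkLenz2013 Thm 7.1 for the hull formalism.]
-/

noncomputable section

namespace Summit.AtomisticToContinuum.Crystallization.Theorems

namespace PeriodCoherenceLadderCleanRegions

open Literature.MathematicalPhysics.StatisticalMechanics
open Filter Topology Metric
open Summit.AtomisticToContinuum.Crystallization.Theorems.PeriodPrecisionLadderExactPeriodFromFine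

/-- **Clean at every scale ⇒ clean everywhere in some hull point** (compactness).  Hypothesis: uniform constants
`δ, r, b`; for every `L` a `δ`-separated, `r`-dense hull point whose balls `B(c, 4b+1)`, `‖c‖ ≤ L`, each carry a
local coarse period.  Conclusion: the conclusion of `PeriodCoherenceLadder.MesoscopicCoarsePeriods` for `x`. -/
theorem mesoscopic_of_cleanRegions (x : (N : ℕ) → (Fin N → EuclideanSpace ℝ (Fin 3)))
    (h : ∃ δ r b : ℝ, 0 < δ ∧ ∀ L : ℝ, ∃ X : Set (EuclideanSpace ℝ (Fin 3)), (∀ p ∈ X, ∀ q ∈ X, p ≠ q → δ ≤ dist p q) ∧ (∀ c : EuclideanSpace ℝ (Fin 3), ∃ p ∈ X, dist p c ≤ r) ∧ (∀ R ε : ℝ, 0 < ε → ∃ᶠ N in Filter.atTop, ∃ t : EuclideanSpace ℝ (Fin 3), (∀ p ∈ X, ‖p‖ ≤ R → ∃ i : Fin N, dist (x N i + t) p ≤ ε) ∧ (∀ i : Fin N, ‖x N i + t‖ ≤ R → ∃ p ∈ X, dist (x N i + t) p ≤ ε)) ∧ ∀ c : EuclideanSpace ℝ (Fin 3), ‖c‖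 ≤ L → ∃ t : EuclideanSpace ℝ (Fin 3), δ ≤ ‖t‖ ∧ ‖t‖ ≤ b ∧ ∀ p ∈ X, dist p c ≤ 4 * b + 1 → (∃ q ∈ X, dist (p + t) q ≤ δ / 4) ∧ (∃ q ∈ X, dist (p - t) q ≤ δ / 4)) :
    ∃ X : Set (EuclideanSpace ℝ (Fin 3)), ∃ δ r b : ℝ, 0 < δ ∧ (∀ p ∈ X, ∀ q ∈ X, p ≠ q → δ ≤ dist p q) ∧ (∀ c : EuclideanSpace ℝ (Fin 3), ∃ p ∈ X, dist p c ≤ r) ∧ (∀ R ε : ℝ, 0 < ε → ∃ᶠ N in Filter.atTop, ∃ t : EuclideanSpace ℝ (Fin 3), (∀ p ∈ X, ‖p‖ ≤ R → ∃ i : Fin N, dist (x N i + t) p ≤ ε) ∧ (∀ i : Fin N, ‖x N i + t‖ ≤ R → ∃ p ∈ X, dist (x N i + t) p ≤ ε)) ∧ ∀ c : EuclideanSpace ℝ (Fin 3), ∃ t : EuclideanSpace ℝ (Fin 3), δ ≤ ‖t‖ ∧ ‖t‖ ≤ b ∧ ∀ p ∈ X, dist p c ≤ 4 * b → (∃ q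 ∈ X, dist (p + t) q ≤ δ / 4) ∧ (∃ q ∈ X, dist (p - t) q ≤ δ / 4) := by
  obtain ⟨δ, r, b, hδ, H⟩ := h
  have H' : ∀ n : ℕ, ∃ X : Set (EuclideanSpace ℝ (Fin 3)),
      (∀ p ∈ X, ∀ q ∈ X, p ≠ q → δ ≤ dist p q) ∧
      (∀ c : EuclideanSpace ℝ (Fin 3), ∃ p ∈ X, dist p c ≤ r) ∧
      (∀ R ε' : ℝ, 0 < ε' → ∃ᶠ N in Filter.atTop, ∃ s : EuclideanSpace ℝ (Fin 3),
        (∀ p ∈ X, ‖p‖ ≤ R → ∃ i : Fin N, dist (x N i + s) p ≤ ε') ∧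
        (∀ i : Fin N, ‖x N i + s‖ ≤ R → ∃ p ∈ X, dist (x N i + s) p ≤ ε')) ∧
      ∀ c : EuclideanSpace ℝ (Fin 3), ‖c‖ ≤ (n : ℝ) → ∃ t : EuclideanSpace ℝ (Fin 3), δ ≤ ‖t‖ ∧ ‖t‖ ≤ b ∧
        ∀ p ∈ X, dist p c ≤ 4 * b + 1 →
          (∃ q ∈ X, dist (p + t) q ≤ δ / 4) ∧ (∃ q ∈ X, dist (p - t) q ≤ δ / 4) := fun n => H (n : ℝ)
  choose X hsep hden hhull hloc using H'
  choose t hta htb hAP using hloc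
  have hb : 0 ≤ b := le_trans (norm_nonneg _) (htb 0 0 (by simp))
  -- local-matching compactness for the sets
  obtain ⟨φ, Y, hφ, hYsep, hmatch⟩ := exists_subseq_forall_eventually_match hδ X hsep
  -- (i) Y is (r+1)-dense
  have hYden : ∀ c : EuclideanSpace ℝ (Fin 3), ∃ p ∈ Y, dist p c ≤ r + 1 := by
    intro c
    obtain ⟨k, hk⟩ := (hmatch (‖c‖ + r) 1 one_pos).exists
    obtain ⟨p, hp, hpc⟩ := hden (φ k) c
    have hpn : ‖p‖ ≤ ‖c‖ + r := by
      have h1 : ‖p‖ ≤ ‖c‖ + dist p c := by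
        have := norm_le_norm_add_norm_sub' p c
        rwa [← dist_eq_norm] at this
      linarith
    obtain ⟨s, hs, hps⟩ := hk.2 p hp hpn
    refine ⟨s, hs, ?_⟩
    calc dist s c ≤ dist p s + dist p c := dist_triangle_left _ _ _
      _ ≤ 1 + r := add_le_add hps hpc
      _ = r + 1 := add_comm _ _
  -- (ii) uniform discreteness: an infimum of distances to Y that is ≤ δ/4 + η for every η > 0 is attained ≤ δ/4
  have hattain : ∀ z : EuclideanSpace ℝ (Fin 3),
      (∀ η : ℝ, 0 < η → ∃ y' ∈ Y, dist z y' ≤ δ / 4 + η) → ∃ y' ∈ Y, dist z y' ≤ δ / 4 := by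
    intro z hz
    by_contra hcon
    push Not at hcon
    have hfin : (Y ∩ closedBall z (δ / 4 + 1)).Finite :=
      finite_of_forall_le_dist_of_subset_closedBall hδ
        (fun p hp q hq hpq => hYsep p hp.1 q hq.1 hpq) Set.inter_subset_right
    obtain ⟨y₁, hy₁, hd₁⟩ := hz 1 one_pos
    have hne : hfin.toFinset.Nonempty := by
      refine ⟨y₁, ?_⟩
      rw [Set.Finite.mem_toFinset]
      exact ⟨hy₁, by rw [mem_closedBall, dist_comm]; exact hd₁⟩
    obtain ⟨y₀, hy₀F, hmin⟩ := hfin.toFinset.exists_min_image (fun y => dist z y) hne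
    rw [Set.Finite.mem_toFinset] at hy₀F
    have hgap : δ / 4 < dist z y₀ := hcon y₀ hy₀F.1
    obtain ⟨y₂, hy₂, hd₂⟩ := hz (min ((dist z y₀ - δ / 4) / 2) 1) (lt_min (by linarith) one_pos)
    have hy₂F : y₂ ∈ hfin.toFinset := by
      rw [Set.Finite.mem_toFinset]
      refine ⟨hy₂, ?_⟩
      rw [mem_closedBall, dist_comm]
      exact hd₂.trans (by linarith [min_le_right ((dist z y₀ - δ / 4) / 2) (1 : ℝ)])
    have h1 := hmin y₂ hy₂F
    have h2 := min_le_left ((dist z y₀ - δ / 4) / 2) (1 : ℝ)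
    have h3 : dist z y₀ ≤ δ / 4 + (dist z y₀ - δ / 4) / 2 := h1.trans (hd₂.trans (by linarith))
    linarith
  -- (iii) Y is a hull point (the hull is closed under local limits)
  have hYhull : ∀ R ε : ℝ, 0 < ε → ∃ᶠ N in Filter.atTop, ∃ s : EuclideanSpace ℝ (Fin 3),
      (∀ p ∈ Y, ‖p‖ ≤ R → ∃ i : Fin N, dist (x N i + s) p ≤ ε) ∧
      (∀ i : Fin N, ‖x N i + s‖ ≤ R → ∃ p ∈ Y, dist (x N i + s) p ≤ ε) := by
    intro R ε hε
    obtain ⟨k, hk⟩ := (hmatch (R + ε) (ε / 2) (by positivity)).exists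
    refine (hhull (φ k) (R + ε) (ε / 2) (by positivity)).mono ?_
    rintro N ⟨s, hs1, hs2⟩
    refine ⟨s, fun p hp hpR => ?_, fun i hi => ?_⟩
    · obtain ⟨q, hq, hqp⟩ := hk.1 p hp (by linarith)
      have hqR : ‖q‖ ≤ R + ε := by
        have h1 : ‖q‖ ≤ ‖p‖ + dist q p := by
          have := norm_le_norm_add_norm_sub' q p
          rwa [← dist_eq_norm] at this
        linarith
      obtain ⟨i, hi⟩ := hs1 q hq hqR
      exact ⟨i, (dist_triangle _ q _).trans (by linarith)⟩
    · obtain ⟨q, hq, hiq⟩ := hs2 i (by linarith)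
      have hqR : ‖q‖ ≤ R + ε := by
        have h1 : ‖q‖ ≤ ‖x N i + s‖ + dist q (x N i + s) := by
          have := norm_le_norm_add_norm_sub' q (x N i + s)
          rwa [← dist_eq_norm] at this
        rw [dist_comm] at h1
        linarith
      obtain ⟨p, hp, hqp⟩ := hk.2 q hq hqR
      exact ⟨p, hp, (dist_triangle _ q _).trans (by linarith)⟩
  refine ⟨Y, δ, r + 1, b, hδ, hYsep, hYden, hYhull, fun c => ?_⟩
  -- (iv) centre by centre: Bolzano–Weierstrass for the local translations along the subsequence
  let s : ℕ → EuclideanSpace ℝ (Fin 3) := fun k => if hk : ‖c‖ ≤ ((φ k : ℕ) : ℝ) then t (φ k) c hk else 0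
  have hsmem : ∀ k, s k ∈ closedBall (0 : EuclideanSpace ℝ (Fin 3)) b := by
    intro k
    by_cases hk : ‖c‖ ≤ ((φ k : ℕ) : ℝ)
    · simp only [s, dif_pos hk, mem_closedBall_zero_iff]
      exact htb _ _ _
    · simp only [s, dif_neg hk, mem_closedBall, dist_self]
      exact hb
  obtain ⟨tinf, htinf, ψ, hψ, hlim⟩ := tendsto_subseq_of_bounded
    (Metric.isBounded_closedBall : Bornology.IsBounded (closedBall (0 : EuclideanSpace ℝ (Fin 3)) b)) hsmem
  have htinf_le : ‖tinf‖ ≤ b := by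
    rw [closure_closedBall, mem_closedBall_zero_iff] at htinf
    exact htinf
  have hψmono : StrictMono (fun j => φ (ψ j)) := hφ.comp hψ
  -- the window radius along the subsequence exceeds ‖c‖ eventually
  have hwin : ∀ᶠ j in atTop, ‖c‖ ≤ ((φ (ψ j) : ℕ) : ℝ) := by
    obtain ⟨m, hm⟩ := exists_nat_ge ‖c‖
    filter_upwards [eventually_ge_atTop m] with j hj
    have h1 : (m : ℝ) ≤ ((φ (ψ j) : ℕ) : ℝ) := by
      exact_mod_cast hj.trans (hψmono.le_apply)
    exact hm.trans h1
  have hta_inf : δ ≤ ‖tinf‖ := by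
    refine ge_of_tendsto hlim.norm ?_
    filter_upwards [hwin] with j hj
    show δ ≤ ‖s (ψ j)‖
    simp only [s, dif_pos hj]
    exact hta _ _ _
  refine ⟨tinf, hta_inf, htinf_le, fun y hy hyc => ?_⟩
  -- (v) the local coarse period of Y at c
  have key : ∀ η : ℝ, 0 < η →
      (∃ y' ∈ Y, dist (y + tinf) y' ≤ δ / 4 + η) ∧ (∃ y' ∈ Y, dist (y - tinf) y' ≤ δ / 4 + η) := by
    intro η hη
    -- work with η₀ = min η 1 so that the matched point stays inside the ball of radius 4b + 1
    set η₀ : ℝ := min η 1 with hη₀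
    have hη₀pos : 0 < η₀ := lt_min hη one_pos
    have hη₀η : η₀ ≤ η := min_le_left _ _
    have hη₀1 : η₀ ≤ 1 := min_le_right _ _
    have e1 := hψ.tendsto_atTop.eventually (hmatch (‖c‖ + 4 * b + b + δ + 1) (η₀ / 4) (by positivity))
    have e3 : ∀ᶠ j in atTop, dist (s (ψ j)) tinf ≤ η₀ / 4 :=
      (Metric.tendsto_nhds.1 hlim (η₀ / 4) (by positivity)).mono fun j hj => hj.le
    obtain ⟨j, hk1, hk3, hkw⟩ := (e1.and (e3.and hwin)).exists
    have hsj : s (ψ j) = t (φ (ψ j)) c hkw := by simp only [s, dif_pos hkw]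
    rw [hsj] at hk3
    have hyn : ‖y‖ ≤ ‖c‖ + 4 * b + b + δ + 1 := by
      have h1 : ‖y‖ ≤ ‖c‖ + dist y c := by
        have := norm_le_norm_add_norm_sub' y c
        rwa [← dist_eq_norm] at this
      linarith [hδ.le]
    obtain ⟨p, hp, hpy⟩ := hk1.1 y hy hyn
    have hpc : dist p c ≤ 4 * b + 1 := by
      calc dist p c ≤ dist p y + dist y c := dist_triangle _ _ _
        _ ≤ η₀ / 4 + 4 * b := add_le_add hpy hyc
        _ ≤ 4 * b + 1 := by linarith
    have hpn : ‖p‖ ≤ ‖y‖ + η₀ / 4 := by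
      have h1 : ‖p‖ ≤ ‖y‖ + dist p y := by
        have := norm_le_norm_add_norm_sub' p y
        rwa [← dist_eq_norm] at this
      linarith
    obtain ⟨⟨q₁, hq₁, hq₁d⟩, ⟨q₂, hq₂, hq₂d⟩⟩ := hAP (φ (ψ j)) c hkw p hp hpc
    have htk : ‖t (φ (ψ j)) c hkw‖ ≤ b := htb _ _ _
    have hyc' : ‖y‖ ≤ ‖c‖ + 4 * b := by
      have h1 : ‖y‖ ≤ ‖c‖ + dist y c := by
        have := norm_le_norm_add_norm_sub' y c
        rwa [← dist_eq_norm] at this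
      linarith
    have hq₁n : ‖q₁‖ ≤ ‖c‖ + 4 * b + b + δ + 1 := by
      have h1 : ‖q₁‖ ≤ ‖p + t (φ (ψ j)) c hkw‖ + dist q₁ (p + t (φ (ψ j)) c hkw) := by
        have := norm_le_norm_add_norm_sub' q₁ (p + t (φ (ψ j)) c hkw)
        rwa [← dist_eq_norm] at this
      have h2 : ‖p + t (φ (ψ j)) c hkw‖ ≤ ‖p‖ + ‖t (φ (ψ j)) c hkw‖ := norm_add_le _ _
      rw [dist_comm] at h1
      linarith
    have hq₂n : ‖q₂‖ ≤ ‖c‖ + 4 * b + b + δ + 1 := by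
      have h1 : ‖q₂‖ ≤ ‖p - t (φ (ψ j)) c hkw‖ + dist q₂ (p - t (φ (ψ j)) c hkw) := by
        have := norm_le_norm_add_norm_sub' q₂ (p - t (φ (ψ j)) c hkw)
        rwa [← dist_eq_norm] at this
      have h2 : ‖p - t (φ (ψ j)) c hkw‖ ≤ ‖p‖ + ‖t (φ (ψ j)) c hkw‖ := norm_sub_le _ _
      rw [dist_comm] at h1
      linarith
    obtain ⟨y₁, hy₁, hqy₁⟩ := hk1.2 q₁ hq₁ hq₁n
    obtain ⟨y₂, hy₂, hqy₂⟩ := hk1.2 q₂ hq₂ hq₂n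
    refine ⟨⟨y₁, hy₁, ?_⟩, ⟨y₂, hy₂, ?_⟩⟩
    · calc dist (y + tinf) y₁
          ≤ dist (y + tinf) (p + t (φ (ψ j)) c hkw) + dist (p + t (φ (ψ j)) c hkw) y₁ := dist_triangle _ _ _
        _ ≤ (dist y p + dist tinf (t (φ (ψ j)) c hkw)) + (dist (p + t (φ (ψ j)) c hkw) q₁ + dist q₁ y₁) :=
            add_le_add (dist_add_add_le _ _ _ _) (dist_triangle _ _ _)
        _ ≤ (η₀ / 4 + η₀ / 4) + (δ / 4 + η₀ / 4) := by
            gcongr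
            · rwa [dist_comm] at hpy
            · rwa [dist_comm] at hk3
        _ ≤ δ / 4 + η := by linarith
    · calc dist (y - tinf) y₂
          ≤ dist (y - tinf) (p - t (φ (ψ j)) c hkw) + dist (p - t (φ (ψ j)) c hkw) y₂ := dist_triangle _ _ _
        _ ≤ (dist y p + dist tinf (t (φ (ψ j)) c hkw)) + (dist (p - t (φ (ψ j)) c hkw) q₂ + dist q₂ y₂) :=
            add_le_add (dist_sub_sub_le _ _ _ _) (dist_triangle _ _ _)
        _ ≤ (η₀ / 4 + η₀ / 4) + (δ / 4 + η₀ / 4) := by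
            gcongr
            · rwa [dist_comm] at hpy
            · rwa [dist_comm] at hk3
        _ ≤ δ / 4 + η := by linarith
  exact ⟨hattain (y + tinf) fun η hη => (key η hη).1, hattain (y - tinf) fun η hη => (key η hη).2⟩

/-- **The packaged reduction of the residual crux.**  `MesoscopicCoarsePeriods` follows from the Lennard-Jones
statement «for every scale `L`, some Delone hull point of the ground states (uniform constants) is clean on the
window of radius `L`» — the LJ-specific remainder of the line (energy localisation of frustration, `o(N)` excess
energy, counting of disjoint bad balls, exposed-site cost for voids). -/
theorem mesoscopicCoarsePeriods_of_cleanRegions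
    (hclean : ∀ x : (N : ℕ) → (Fin N → EuclideanSpace ℝ (Fin 3)), (∀ N, Literature.MathematicalPhysics.StatisticalMechanics.IsGroundState Literature.MathematicalPhysics.StatisticalMechanics.lennardJones (x N)) → (∃ X : Set (EuclideanSpace ℝ (Fin 3)), ((∃ δ : ℝ, 0 < δ ∧ ∀ p ∈ X, ∀ q ∈ X, p ≠ q → δ ≤ dist p q) ∧ (∃ r : ℝ, ∀ c : EuclideanSpace ℝ (Fin 3), ∃ p ∈ X, dist p c ≤ r)) ∧ (∀ R ε : ℝ, 0 < ε → ∃ᶠ N in Filter.atTop, ∃ t : EuclideanSpace ℝ (Fin 3), (∀ p ∈ X, ‖p‖ ≤ R → ∃ i : Fin N, dist (x N i + t) p ≤ ε) ∧ (∀ i : Fin N, ‖x N i + t‖ ≤ R → ∃ p ∈ X, dist (x N i + t) p ≤ ε))) → ∃ δ r b : ℝ, 0 < δ ∧ ∀ L : ℝ, ∃ X : Set (EuclideanSpace ℝ (Fin 3)), (∀ p ∈ X, ∀ q ∈ X, p ≠ q → δ ≤ dist p q) ∧ (∀ c : EuclideanSpace ℝ (Fin 3), ∃ p ∈ X, dist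 p c ≤ r) ∧ (∀ R ε : ℝ, 0 < ε → ∃ᶠ N in Filter.atTop, ∃ t : EuclideanSpace ℝ (Fin 3), (∀ p ∈ X, ‖p‖ ≤ R → ∃ i : Fin N, dist (x N i + t) p ≤ ε) ∧ (∀ i : Fin N, ‖x N i + t‖ ≤ R → ∃ p ∈ X, dist (x N i + t) p ≤ ε)) ∧ ∀ c : EuclideanSpace ℝ (Fin 3), ‖c‖ ≤ L → ∃ t : EuclideanSpace ℝ (Fin 3), δ ≤ ‖t‖ ∧ ‖t‖ ≤ b ∧ ∀ p ∈ X, dist p c ≤ 4 * b + 1 → (∃ q ∈ X, dist (p + t) q ≤ δ / 4) ∧ (∃ q ∈ X, dist (p - t) q ≤ δ / 4)) :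
    Summit.AtomisticToContinuum.Crystallization.Theses.PeriodCoherenceLadder.MesoscopicCoarsePeriods := by
  intro x hx h0
  exact mesoscopic_of_cleanRegions x (hclean x hx h0)

end PeriodCoherenceLadderCleanRegions

end Summit.AtomisticToContinuum.Crystallization.Theorems

end
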